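import Summits.Schanuel.Schanuel.Theorems.RootDecomp1KGapCell03

/-!
# RootDecomp1KGapCell — lens 1, generation 42 «GAP CELL / INTERLACED SPECIALISATION» (lane K-R26 (α-loc)): the walls (1, ℓ_b, ρ), (1, ℓ₂, ℓ₃, ρ) (mod hNW), their π-twins and the 31077 pair (ℓ_b, ρ) HYPOTHESIS-FREE for every ρ ∈ `FactorialGapLiouville` — located order data strictly below the log-log floor; member ρ_W — continuation (RootDecomp1KGapCell04): §3 THE CELLS (pair hypothesis-free at 31077; walls mod hNW; π-twins free) + §4 THE LIVE ITEMS in item shape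

(lens-1 g42 `GapCell.lean` EDITION 3 [HOME/decomp-schanuel-lens-1/g42/ sha256 6f7828b1…, 2470 l; VERDICT L2004, EDITIONS 2+3 L2018, ACK L2023]; port by census-1 gen 17 as
`RootDecomp1KGapCell01`–`10` — see the PORT NOTE of part 01; `--supports stmt-Schanuel-33364` (04: `stmt-Schanuel-31077`); rung 0.)
-/

open Summit.Schanuel.Schanuel.Theorems.RootDecomp1KHyper
open Summit.Schanuel.Schanuel.Theorems.RootDecomp1KHyper.HyperCell
open Summit.Schanuel.Schanuel.Theorems.RootDecomp1KRelLiouvilleCell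
open Summit.Schanuel.Schanuel.Theorems.RootDecomp1KLogLogCell
open Summit.Schanuel.Schanuel.Theorems.RootDecomp1KTwoBaseCell
open LiouvilleNumber
open scoped Nat

namespace Summit.Schanuel.Schanuel.Theorems.RootDecomp1KGapCell

variable {k n : ℕ}

/-! ## §3  THE CELLS: `(ℓ_b, ρ)` hypothesis-free; the walls `(1, ℓ_b, ρ)`, `(1, ℓ₂, ℓ₃, ρ)` mod `hNW`; π-twins free -/

section Cells
variable {k : ℕ}
open IntermediateField

/-- The empty tuple has (trivially) a polynomial measure of algebraic independence. -/
private theorem mvPolyMeasure_fin_zero (θ : Fin 0 → ℂ) : MvPolyMeasure θ := by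
  intro d
  refine ⟨1, 0, one_pos, fun P hP _ => ?_⟩
  have hP' : P = MvPolynomial.C (P.coeff 0) := P.eq_C_of_isEmpty
  have hc : P.coeff 0 ≠ 0 := by
    intro h; apply hP; rw [hP', h, map_zero]
  have hval : MvPolynomial.aeval θ P = ((P.coeff 0 : ℤ) : ℂ) := by
    rw [hP', MvPolynomial.aeval_C, algebraMap_int_eq, eq_intCast, MvPolynomial.coeff_C, if_pos rfl]
  rw [pow_zero, mul_one, one_mul, hval, Complex.norm_intCast]
  exact_mod_cast Int.one_le_abs hc

/-- Weights of a single base `b ≥ 2` are injective. -/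
theorem wt_injective_single {b : ℕ} (hb : 2 ≤ b) : Function.Injective (wt (![b] : Fin 1 → ℕ)) :=
  wt_injective_of_pairwise_coprime (fun i => by fin_cases i; simpa using hb)
    (fun i j hij => absurd (Subsingleton.elim i j) hij)

/-- **`(ρ, ℓ_{b_1}, …, ℓ_{b_k})` is algebraically independent — HYPOTHESIS-FREE** (engine with the empty `θ⃗`). -/
theorem algebraicIndependent_gapBlock {b : Fin k → ℕ} (hb : ∀ i, 2 ≤ b i)
    (hinj : Function.Injective (wt b)) {ρ : ℝ} (hρ : FactorialGapLiouville ρ) :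
    AlgebraicIndependent ℚ
      (Fin.cons (ρ : ℂ) (fun i => ((liouvilleNumber (b i) : ℝ) : ℂ)) : Fin (k + 1) → ℂ) := by
  have h := algebraicIndependent_gap_of_mvPolyMeasure hb hinj hρ (mvPolyMeasure_fin_zero Fin.elim0)
  have h2 := h.comp Sum.inl Sum.inl_injective
  rwa [Sum.elim_comp_inl] at h2

/-- **THE PAIR CELL `(ℓ_b, ρ)`, `ρ` gap-Liouville: `SB 2` — HYPOTHESIS-FREE** (scope of 31077: `ℓ_b` is a Liouville
coordinate).  No measure, no `hNW`: the two specialised coordinates ARE the whole tuple. -/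
theorem sb_gapPair {b : ℕ} (hb : 2 ≤ b) {ρ : ℝ} (hρ : FactorialGapLiouville ρ) :
    SB 2 ![((liouvilleNumber b : ℝ) : ℂ), (ρ : ℂ)] := by
  have hai := algebraicIndependent_gapBlock (b := ![b]) (fun i => by fin_cases i; simpa using hb)
    (wt_injective_single hb) hρ
  refine sb_of_algebraicIndependent hai (by simp) ?_
  intro i
  refine Fin.cases ?_ (fun j => ?_) i
  · simp only [Fin.cons_zero]
    exact subset_adjoin ℚ _ (Or.inl (Or.inl ⟨1, by simp⟩))
  · simp only [Fin.cons_succ]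
    refine subset_adjoin ℚ _ (Or.inl (Or.inl ⟨0, ?_⟩))
    fin_cases j; simp

/-- **THE WALL CELL `(1, ℓ_b, ρ)`, `ρ` gap-Liouville: `SB 3`** (mod `hNW : NWMeasure` BY NAME — the measure of
`e = exp 1` is the engine's `θ⃗ = (e)`). -/
theorem sb_gapWall3 (hNW : NWMeasure) {b : ℕ} (hb : 2 ≤ b) {ρ : ℝ} (hρ : FactorialGapLiouville ρ) :
    SB 3 ![(1 : ℂ), ((liouvilleNumber b : ℝ) : ℂ), (ρ : ℂ)] := by
  have hai := algebraicIndependent_gap_of_mvPolyMeasure (b := ![b])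
    (fun i => by fin_cases i; simpa using hb) (wt_injective_single hb) hρ
    (mvPolyMeasure_one_of_polyMeasure (polyMeasure_exp_one_of_NW hNW))
  refine sb_of_algebraicIndependent hai (by simp) ?_
  intro x
  rcases x with i | j
  · simp only [Sum.elim_inl]
    refine Fin.cases ?_ (fun j => ?_) i
    · simp only [Fin.cons_zero]
      exact subset_adjoin ℚ _ (Or.inl (Or.inl ⟨2, by simp⟩))
    · simp only [Fin.cons_succ]
      refine subset_adjoin ℚ _ (Or.inl (Or.inl ⟨1, ?_⟩))
      fin_cases j; simp
  · simp only [Sum.elim_inr]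
    refine subset_adjoin ℚ _ (Or.inl (Or.inr ⟨0, ?_⟩))
    fin_cases j; simp

/-- **THE WALL CELL, π-twin `(π, πℓ_b, πρ)`: `SB 3` — HYPOTHESIS-FREE** (`θ⃗ = (π)`, tree `polyMeasure_pi`). -/
theorem sb_gapWall3_pi {b : ℕ} (hb : 2 ≤ b) {ρ : ℝ} (hρ : FactorialGapLiouville ρ) :
    SB 3 ![(Real.pi : ℂ), (Real.pi : ℂ) * ((liouvilleNumber b : ℝ) : ℂ), (Real.pi : ℂ) * (ρ : ℂ)] := by
  set z : Fin 3 → ℂ :=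
    ![(Real.pi : ℂ), (Real.pi : ℂ) * ((liouvilleNumber b : ℝ) : ℂ), (Real.pi : ℂ) * (ρ : ℂ)] with hz
  have hπ0 : (Real.pi : ℂ) ≠ 0 := by exact_mod_cast Real.pi_ne_zero
  have hzm : ∀ i, z i ∈ adjoin ℚ (SFset z ∪ {Complex.I}) := fun i =>
    subset_adjoin ℚ _ (Or.inl (Or.inl ⟨i, rfl⟩))
  have hai := algebraicIndependent_gap_of_mvPolyMeasure (b := ![b])
    (fun i => by fin_cases i; simpa using hb) (wt_injective_single hb) hρ
    (mvPolyMeasure_one_of_polyMeasure polyMeasure_pi)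
  refine sb_of_algebraicIndependent hai (by simp) ?_
  intro x
  rcases x with i | j
  · simp only [Sum.elim_inl]
    refine Fin.cases ?_ (fun j => ?_) i
    · simp only [Fin.cons_zero]
      have e : (ρ : ℂ) = z 2 / z 0 := by simp [hz, mul_div_cancel_left₀ _ hπ0]
      rw [e]; exact div_mem (hzm 2) (hzm 0)
    · simp only [Fin.cons_succ]
      have e : ((liouvilleNumber (![b] j) : ℝ) : ℂ) = z 1 / z 0 := by
        fin_cases j; simp [hz, mul_div_cancel_left₀ _ hπ0]
      rw [e]; exact div_mem (hzm 1) (hzm 0)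
  · simp only [Sum.elim_inr]
    have e : (![(Real.pi : ℂ)] : Fin 1 → ℂ) j = z 0 := by fin_cases j; simp [hz]
    rw [e]; exact hzm 0

/-- **THE TWO-BASE WALL CELL `(1, ℓ₂, ℓ₃, ρ)`, `ρ` gap-Liouville: `SB 4`** (mod `hNW` BY NAME) — RULE K-R26's wall
with the Liouville coordinate STRICTLY BELOW the log-log floor (members: §5). -/
theorem sb_gapWall4 (hNW : NWMeasure) {ρ : ℝ} (hρ : FactorialGapLiouville ρ) :
    SB 4 ![(1 : ℂ), ((liouvilleNumber 2 : ℝ) : ℂ), ((liouvilleNumber 3 : ℝ) : ℂ), (ρ : ℂ)] := by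
  have hai := algebraicIndependent_gap_of_mvPolyMeasure two_le_b23 wt_b23_injective hρ
    (mvPolyMeasure_one_of_polyMeasure (polyMeasure_exp_one_of_NW hNW))
  refine sb_of_algebraicIndependent hai (by simp) ?_
  intro x
  rcases x with i | j
  · simp only [Sum.elim_inl]
    refine Fin.cases ?_ (fun j => ?_) i
    · simp only [Fin.cons_zero]
      exact subset_adjoin ℚ _ (Or.inl (Or.inl ⟨3, by simp⟩))
    · simp only [Fin.cons_succ]
      fin_cases j
      · exact subset_adjoin ℚ _ (Or.inl (Or.inl ⟨1, by simp [b23]⟩))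
      · exact subset_adjoin ℚ _ (Or.inl (Or.inl ⟨2, by simp [b23]⟩))
  · simp only [Sum.elim_inr]
    refine subset_adjoin ℚ _ (Or.inl (Or.inr ⟨0, ?_⟩))
    fin_cases j; simp

/-- **THE TWO-BASE WALL CELL, π-twin `(π, πℓ₂, πℓ₃, πρ)`: `SB 4` — HYPOTHESIS-FREE.** -/
theorem sb_gapWall4_pi {ρ : ℝ} (hρ : FactorialGapLiouville ρ) :
    SB 4 ![(Real.pi : ℂ), (Real.pi : ℂ) * ((liouvilleNumber 2 : ℝ) : ℂ),
      (Real.pi : ℂ) * ((liouvilleNumber 3 : ℝ) : ℂ), (Real.pi : ℂ) * (ρ : ℂ)] := by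
  set z : Fin 4 → ℂ := ![(Real.pi : ℂ), (Real.pi : ℂ) * ((liouvilleNumber 2 : ℝ) : ℂ),
      (Real.pi : ℂ) * ((liouvilleNumber 3 : ℝ) : ℂ), (Real.pi : ℂ) * (ρ : ℂ)] with hz
  have hπ0 : (Real.pi : ℂ) ≠ 0 := by exact_mod_cast Real.pi_ne_zero
  have hzm : ∀ i, z i ∈ adjoin ℚ (SFset z ∪ {Complex.I}) := fun i =>
    subset_adjoin ℚ _ (Or.inl (Or.inl ⟨i, rfl⟩))
  have hai := algebraicIndependent_gap_of_mvPolyMeasure two_le_b23 wt_b23_injective hρ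
    (mvPolyMeasure_one_of_polyMeasure polyMeasure_pi)
  refine sb_of_algebraicIndependent hai (by simp) ?_
  intro x
  rcases x with i | j
  · simp only [Sum.elim_inl]
    refine Fin.cases ?_ (fun j => ?_) i
    · simp only [Fin.cons_zero]
      have e : (ρ : ℂ) = z 3 / z 0 := by simp [hz, mul_div_cancel_left₀ _ hπ0]
      rw [e]; exact div_mem (hzm 3) (hzm 0)
    · simp only [Fin.cons_succ]
      fin_cases j
      · show ((liouvilleNumber (b23 0) : ℝ) : ℂ) ∈ _
        have e : ((liouvilleNumber (b23 0) : ℝ) : ℂ) = z 1 / z 0 := by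
          simp [hz, b23, mul_div_cancel_left₀ _ hπ0]
        rw [e]; exact div_mem (hzm 1) (hzm 0)
      · show ((liouvilleNumber (b23 1) : ℝ) : ℂ) ∈ _
        have e : ((liouvilleNumber (b23 1) : ℝ) : ℂ) = z 2 / z 0 := by
          simp [hz, b23, mul_div_cancel_left₀ _ hπ0]
        rw [e]; exact div_mem (hzm 2) (hzm 0)
  · simp only [Sum.elim_inr]
    have e : (![(Real.pi : ℂ)] : Fin 1 → ℂ) j = z 0 := by fin_cases j; simp [hz]
    rw [e]; exact hzm 0

end Cells

/-! ## §4  THE LIVE ITEMS ON THE GAP CELLS (binders VERBATIM + ONE `Set.range` line) -/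

section Items

/-- **ITEM 33364 ON THE GAP WALL `(1, ℓ_b, ρ)`** (e-version, mod `hNW` BY NAME).  Binders of
`Summit.Schanuel.Schanuel.Theses.RootDecomp1K.FiniteOrderLiouvilleSchanuel` VERBATIM, with ONE line inserted after
`LinearIndependent ℚ z` — the cell `Set.range z = Set.range ![1, ℓ_b, ρ]`, `ρ` ranging over the GAP-LIOUVILLE reals
(outer parameters `b ≥ 2`, `ρ`, `hρ : FactorialGapLiouville ρ` — ORDER DATA ONLY).  The two Diophantine binders
are not used by the proof (the conclusion holds outright on the cell); the first is CERTIFIED at the members (§6). -/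
theorem finiteOrderLiouvilleSchanuel_gapWall3 (hNW : NWMeasure) {b : ℕ} (hb : 2 ≤ b) {ρ : ℝ}
    (hρ : FactorialGapLiouville ρ) :
    ∀ (n : ℕ) (z : Fin n → ℂ), LinearIndependent ℚ z →
      Set.range z = Set.range ![(1 : ℂ), ((liouvilleNumber b : ℝ) : ℂ), (ρ : ℂ)] →
      (∀ ω : ℕ, ∃ h : Fin n → ℤ, h ≠ 0 ∧ ‖∑ i, (h i : ℂ) * z i‖ < 1 / (1 + ∑ i, (|h i| : ℝ)) ^ ω) →
      (¬ ∀ m : ℕ, ∃ h : Fin n → ℤ, h ≠ 0 ∧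
        ‖∑ i, (h i : ℂ) * z i‖ < Real.exp (-((1 + ∑ i, (|h i| : ℝ)) ^ m))) →
      (n : Cardinal) ≤ Algebra.trdeg ℚ
        ↥(IntermediateField.adjoin ℚ (Set.range z ∪ Set.range (Complex.exp ∘ z))) := by
  intro n z hz hrange _ _
  exact sb_of_range_eq' hz.injective hrange (sb_gapWall3 hNW hb hρ)

/-- **ITEM 33364 ON THE GAP WALL, π-twin `(π, πℓ_b, πρ)` — HYPOTHESIS-FREE.** -/
theorem finiteOrderLiouvilleSchanuel_gapWall3_pi {b : ℕ} (hb : 2 ≤ b) {ρ : ℝ}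
    (hρ : FactorialGapLiouville ρ) :
    ∀ (n : ℕ) (z : Fin n → ℂ), LinearIndependent ℚ z →
      Set.range z = Set.range ![(Real.pi : ℂ), (Real.pi : ℂ) * ((liouvilleNumber b : ℝ) : ℂ),
        (Real.pi : ℂ) * (ρ : ℂ)] →
      (∀ ω : ℕ, ∃ h : Fin n → ℤ, h ≠ 0 ∧ ‖∑ i, (h i : ℂ) * z i‖ < 1 / (1 + ∑ i, (|h i| : ℝ)) ^ ω) →
      (¬ ∀ m : ℕ, ∃ h : Fin n → ℤ, h ≠ 0 ∧
        ‖∑ i, (h i : ℂ) * z i‖ < Real.exp (-((1 + ∑ i, (|h i| : ℝ)) ^ m))) →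
      (n : Cardinal) ≤ Algebra.trdeg ℚ
        ↥(IntermediateField.adjoin ℚ (Set.range z ∪ Set.range (Complex.exp ∘ z))) := by
  intro n z hz hrange _ _
  exact sb_of_range_eq' hz.injective hrange (sb_gapWall3_pi hb hρ)

/-- **ITEM 33364 ON THE TWO-BASE GAP WALL `(1, ℓ₂, ℓ₃, ρ)`** (e-version, mod `hNW` BY NAME) — RULE K-R26's wall
`(1, ℓ₂, ℓ₃, ρ)` with `ρ` an ORDER-DATA-ONLY Liouville coordinate (members strictly below the log-log floor: §6). -/
theorem finiteOrderLiouvilleSchanuel_gapWall4 (hNW : NWMeasure) {ρ : ℝ} (hρ : FactorialGapLiouville ρ) :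
    ∀ (n : ℕ) (z : Fin n → ℂ), LinearIndependent ℚ z →
      Set.range z = Set.range ![(1 : ℂ), ((liouvilleNumber 2 : ℝ) : ℂ), ((liouvilleNumber 3 : ℝ) : ℂ),
        (ρ : ℂ)] →
      (∀ ω : ℕ, ∃ h : Fin n → ℤ, h ≠ 0 ∧ ‖∑ i, (h i : ℂ) * z i‖ < 1 / (1 + ∑ i, (|h i| : ℝ)) ^ ω) →
      (¬ ∀ m : ℕ, ∃ h : Fin n → ℤ, h ≠ 0 ∧
        ‖∑ i, (h i : ℂ) * z i‖ < Real.exp (-((1 + ∑ i, (|h i| : ℝ)) ^ m))) →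
      (n : Cardinal) ≤ Algebra.trdeg ℚ
        ↥(IntermediateField.adjoin ℚ (Set.range z ∪ Set.range (Complex.exp ∘ z))) := by
  intro n z hz hrange _ _
  exact sb_of_range_eq' hz.injective hrange (sb_gapWall4 hNW hρ)

/-- **ITEM 33364 ON THE TWO-BASE GAP WALL, π-twin `(π, πℓ₂, πℓ₃, πρ)` — HYPOTHESIS-FREE.** -/
theorem finiteOrderLiouvilleSchanuel_gapWall4_pi {ρ : ℝ} (hρ : FactorialGapLiouville ρ) :
    ∀ (n : ℕ) (z : Fin n → ℂ), LinearIndependent ℚ z →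
      Set.range z = Set.range ![(Real.pi : ℂ), (Real.pi : ℂ) * ((liouvilleNumber 2 : ℝ) : ℂ),
        (Real.pi : ℂ) * ((liouvilleNumber 3 : ℝ) : ℂ), (Real.pi : ℂ) * (ρ : ℂ)] →
      (∀ ω : ℕ, ∃ h : Fin n → ℤ, h ≠ 0 ∧ ‖∑ i, (h i : ℂ) * z i‖ < 1 / (1 + ∑ i, (|h i| : ℝ)) ^ ω) →
      (¬ ∀ m : ℕ, ∃ h : Fin n → ℤ, h ≠ 0 ∧
        ‖∑ i, (h i : ℂ) * z i‖ < Real.exp (-((1 + ∑ i, (|h i| : ℝ)) ^ m))) →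
      (n : Cardinal) ≤ Algebra.trdeg ℚ
        ↥(IntermediateField.adjoin ℚ (Set.range z ∪ Set.range (Complex.exp ∘ z))) := by
  intro n z hz hrange _ _
  exact sb_of_range_eq' hz.injective hrange (sb_gapWall4_pi hρ)

/-- **ITEM 31077 ON THE GAP PAIR `(ℓ_b, ρ)` — HYPOTHESIS-FREE.**  Binders of
`Summit.Schanuel.Schanuel.Theses.RootDecomp1K.CoordLiouvilleSchanuel` VERBATIM, with ONE line inserted after
`LinearIndependent ℚ z` — the cell `Set.range z = Set.range ![ℓ_b, ρ]`, `ρ` gap-Liouville (`ℓ_b` is the Liouville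
coordinate of the scope; the scope binder is not used by the proof and is CERTIFIED at the members, §6). -/
theorem coordLiouvilleSchanuel_gapPair {b : ℕ} (hb : 2 ≤ b) {ρ : ℝ} (hρ : FactorialGapLiouville ρ) :
    ∀ (n : ℕ) (z : Fin n → ℂ), LinearIndependent ℚ z →
      Set.range z = Set.range ![((liouvilleNumber b : ℝ) : ℂ), (ρ : ℂ)] →
      (∃ w ∈ Submodule.span ℚ (Set.range z), Liouville w.re ∨ Liouville w.im) →
      (n : Cardinal) ≤ Algebra.trdeg ℚ
        ↥(IntermediateField.adjoin ℚ (Set.range z ∪ Set.range (Complex.exp ∘ z))) := by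
  intro n z hz hrange _
  exact sb_of_range_eq' hz.injective hrange (sb_gapPair hb hρ)

/-- **ITEM 31077 ON THE GAP WALL `(1, ℓ_b, ρ)`** (mod `hNW` BY NAME; binders verbatim + the cell line). -/
theorem coordLiouvilleSchanuel_gapWall3 (hNW : NWMeasure) {b : ℕ} (hb : 2 ≤ b) {ρ : ℝ}
    (hρ : FactorialGapLiouville ρ) :
    ∀ (n : ℕ) (z : Fin n → ℂ), LinearIndependent ℚ z →
      Set.range z = Set.range ![(1 : ℂ), ((liouvilleNumber b : ℝ) : ℂ), (ρ : ℂ)] →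
      (∃ w ∈ Submodule.span ℚ (Set.range z), Liouville w.re ∨ Liouville w.im) →
      (n : Cardinal) ≤ Algebra.trdeg ℚ
        ↥(IntermediateField.adjoin ℚ (Set.range z ∪ Set.range (Complex.exp ∘ z))) := by
  intro n z hz hrange _
  exact sb_of_range_eq' hz.injective hrange (sb_gapWall3 hNW hb hρ)

/-- **ITEM 31077 ON THE TWO-BASE GAP WALL `(1, ℓ₂, ℓ₃, ρ)`** (mod `hNW` BY NAME; binders verbatim + the cell line). -/
theorem coordLiouvilleSchanuel_gapWall4 (hNW : NWMeasure) {ρ : ℝ} (hρ : FactorialGapLiouville ρ) :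
    ∀ (n : ℕ) (z : Fin n → ℂ), LinearIndependent ℚ z →
      Set.range z = Set.range ![(1 : ℂ), ((liouvilleNumber 2 : ℝ) : ℂ), ((liouvilleNumber 3 : ℝ) : ℂ),
        (ρ : ℂ)] →
      (∃ w ∈ Submodule.span ℚ (Set.range z), Liouville w.re ∨ Liouville w.im) →
      (n : Cardinal) ≤ Algebra.trdeg ℚ
        ↥(IntermediateField.adjoin ℚ (Set.range z ∪ Set.range (Complex.exp ∘ z))) := by
  intro n z hz hrange _
  exact sb_of_range_eq' hz.injective hrange (sb_gapWall4 hNW hρ)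

end Items

end Summit.Schanuel.Schanuel.Theorems.RootDecomp1KGapCell
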